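import Literature.AlgebraicTopology.SingularHomology.ChainSubcomplex
import HarnessLib

/-!
# Relative Mayer–Vietoris, algebraic core: subcomplexes modulo a common subcomplex (Hatcher §2.2)

A. Hatcher, *Algebraic Topology* (2002), §2.2, p. 152 ("There is also a relative form of the
Mayer–Vietoris sequence …"): for pairs `(A, C), (B, D)` with `X = int A ∪ int B`,
`Y = int C ∪ int D`, the short exact sequence of quotients
`0 → C(A ∩ B)/C(C ∩ D) → C(A)/C(C) ⊕ C(B)/C(D) → (C(A)+C(B))/(C(C)+C(D)) → 0`.
This file supplies the purely algebraic part for a COMMON subcomplex `𝒜` (the case `C = D`,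
which is the one needed for pairs `(U, U ∖ S)` with `U` open varying and `S` fixed, after the
excision `Hₙ(U, U ∖ S) ≅ Hₙ(U ∪ (X ∖ S), X ∖ S)`): for subcomplexes `𝒜, S, T` of a complex `K`
of `R`-modules, the images `S̄ = π(S)`, `T̄ = π(T)` in `K/𝒜` (`Subcomplex.mapπ`) satisfy
`π(S ⊔ T) = S̄ ⊔ T̄` always and `π(S ⊓ T) = S̄ ⊓ T̄` when `𝒜 ≤ S` (or `𝒜 ≤ T`), so that the
tree's short exact Mayer–Vietoris sequence of subcomplexes `Subcomplex.mvSub S̄ T̄`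
(`0 → S̄ ⊓ T̄ → S̄ ⊞ T̄ → S̄ ⊔ T̄ → 0`, `mvSub_shortExact`) IS the relative Mayer–Vietoris short
exact sequence `0 → (S ⊓ T)/𝒜 → S/𝒜 ⊞ T/𝒜 → (S ⊔ T)/𝒜 → 0`. The identification
`S/(𝒜 ⊓ S) ≅ S̄` is `Subcomplex.toMapπ` (degreewise onto, kernel `𝒜.comap S.ι`).

Everything is proved; the only definitions are the two constructions just named.

## References

* [HatcherAT2002] A. Hatcher, Algebraic Topology, CUP 2002, §2.2 p. 152 (relative
  Mayer–Vietoris) and §2.1 (quotient complexes `C(X, A) = C(X)/C(A)`).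
-/

noncomputable section

open CategoryTheory Limits

universe v w t

namespace Literature.AlgebraicTopology.SingularHomology

variable {R : Type v} [CommRing R]

namespace Subcomplex

variable {β : Type t} {c : ComplexShape β} {K : HomologicalComplex (ModuleCat.{w} R) c}

/-- The image `π(S) ⊆ K/𝒜` of a subcomplex `S ⊆ K` in the quotient by another subcomplex `𝒜`
(Hatcher 2002, §2.2, the quotients `C(A)/C(C)` of the relative Mayer–Vietoris sequence, viewed
inside `C(X)/C(C)`). [cite: HatcherAT2002, §2.2 p. 152] -/
def mapπ (𝒜 S : Subcomplex K) : Subcomplex 𝒜.quotient where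
  carrier i := (S i).map (𝒜.π.f i).hom
  d_mem' {i j x} hx := by
    obtain ⟨y, hy, rfl⟩ := Submodule.mem_map.1 hx
    refine Submodule.mem_map.2 ⟨K.d i j y, S.d_mem hy, ?_⟩
    exact (𝒜.quotient_d_π_f i j y).symm

/-- Membership in `π(S)`: `x̄ ∈ π(S)ᵢ ↔ ∃ y ∈ Sᵢ, π y = x̄`. [folklore] -/
lemma mem_mapπ_iff (𝒜 S : Subcomplex K) (i : β) (x : 𝒜.quotient.X i) :
    x ∈ mapπ 𝒜 S i ↔ ∃ y ∈ S i, 𝒜.π.f i y = x :=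
  Submodule.mem_map

/-- `π y ∈ π(S)` for `y ∈ S`. [folklore] -/
lemma π_f_mem_mapπ (𝒜 S : Subcomplex K) (i : β) {y : K.X i} (hy : y ∈ S i) :
    𝒜.π.f i y ∈ mapπ 𝒜 S i :=
  (mem_mapπ_iff 𝒜 S i _).2 ⟨y, hy, rfl⟩

/-- For `𝒜 ≤ S`: `π y ∈ π(S) ↔ y ∈ S`. [folklore] -/
lemma π_f_mem_mapπ_iff {𝒜 S : Subcomplex K} (h : 𝒜 ≤ S) (i : β) (y : K.X i) :
    𝒜.π.f i y ∈ mapπ 𝒜 S i ↔ y ∈ S i := by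
  refine ⟨fun hy ↦ ?_, π_f_mem_mapπ 𝒜 S i⟩
  obtain ⟨z, hz, hzy⟩ := (mem_mapπ_iff 𝒜 S i _).1 hy
  have hzy' : z - y ∈ 𝒜 i := (𝒜.π_f_eq_π_f_iff i z y).1 hzy
  have : y = z - (z - y) := by abel
  rw [this]
  exact (S i).sub_mem hz (h i hzy')

/-- `π(·)` is monotone. [folklore] -/
lemma mapπ_mono (𝒜 : Subcomplex K) {S T : Subcomplex K} (h : S ≤ T) : mapπ 𝒜 S ≤ mapπ 𝒜 T :=
  fun i ↦ Submodule.map_mono (h i)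

/-- `π(S ⊔ T) = π(S) ⊔ π(T)` (images commute with sums). [cite: HatcherAT2002, §2.2 p. 152] -/
lemma mapπ_sup (𝒜 S T : Subcomplex K) : mapπ 𝒜 (S ⊔ T) = mapπ 𝒜 S ⊔ mapπ 𝒜 T :=
  ext fun _ ↦ Submodule.map_sup _ _ _

/-- `π(S ⊓ T) = π(S) ⊓ π(T)` as soon as `𝒜 ≤ S` (if `π s = π t` with `s ∈ S`, `t ∈ T`, then
`t = s - (s - t) ∈ S`). [cite: HatcherAT2002, §2.2 p. 152] -/
lemma mapπ_inf {𝒜 S : Subcomplex K} (h : 𝒜 ≤ S) (T : Subcomplex K) :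
    mapπ 𝒜 (S ⊓ T) = mapπ 𝒜 S ⊓ mapπ 𝒜 T := by
  refine le_antisymm (fun i ↦ Submodule.map_inf_le _) fun i x hx ↦ ?_
  obtain ⟨hxS, hxT⟩ := (Submodule.mem_inf.1 hx :)
  obtain ⟨t, ht, rfl⟩ := (mem_mapπ_iff 𝒜 T i x).1 hxT
  exact π_f_mem_mapπ 𝒜 (S ⊓ T) i ⟨(π_f_mem_mapπ_iff h i t).1 hxS, ht⟩

/-- `π(𝒜) = ⊥` in `K/𝒜`. [folklore] -/
lemma mapπ_self (𝒜 : Subcomplex K) : mapπ 𝒜 𝒜 = ⊥ := by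
  refine ext fun i ↦ ?_
  rw [bot_apply, Submodule.eq_bot_iff]
  intro x hx
  obtain ⟨y, hy, rfl⟩ := (mem_mapπ_iff 𝒜 𝒜 i x).1 hx
  exact (𝒜.π_f_eq_zero_iff i y).2 hy

/-- `π(⊤) = ⊤` in `K/𝒜`. [folklore] -/
lemma mapπ_top (𝒜 : Subcomplex K) : mapπ 𝒜 ⊤ = ⊤ := by
  refine ext fun i ↦ ?_
  rw [top_apply, Submodule.eq_top_iff']
  intro x
  obtain ⟨y, rfl⟩ := 𝒜.π_f_surjective i x
  exact π_f_mem_mapπ 𝒜 ⊤ i trivial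

/-- The canonical chain map `S → π(S)`, `s ↦ π s` (Hatcher 2002, §2.1: `C(A) → C(A)/C(C)`).
[cite: HatcherAT2002, §2.2 p. 152] -/
def toMapπ (𝒜 S : Subcomplex K) : S.toComplex ⟶ (mapπ 𝒜 S).toComplex :=
  (mapπ 𝒜 S).lift (S.ι ≫ 𝒜.π) fun i x ↦ π_f_mem_mapπ 𝒜 S i (S.ι_f_mem i x)

/-- `toMapπ` followed by the inclusion is `ι ≫ π`. [folklore] -/
@[reassoc]
lemma toMapπ_ι (𝒜 S : Subcomplex K) : toMapπ 𝒜 S ≫ (mapπ 𝒜 S).ι = S.ι ≫ 𝒜.π :=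
  lift_ι _ _ _

/-- The value of `toMapπ`: `(toMapπ s).1 = π s.1`. [folklore] -/
lemma toMapπ_f_apply_val (𝒜 S : Subcomplex K) (i : β) (x : S.toComplex.X i) :
    ((toMapπ 𝒜 S).f i x).1 = 𝒜.π.f i x.1 :=
  lift_f_apply_val _ _ _ i x

/-- `toMapπ` is onto in each degree. [folklore] -/
lemma toMapπ_f_surjective (𝒜 S : Subcomplex K) (i : β) :
    Function.Surjective ((toMapπ 𝒜 S).f i) := by
  rintro ⟨x, hx⟩
  obtain ⟨y, hy, rfl⟩ := (mem_mapπ_iff 𝒜 S i x).1 hx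
  exact ⟨⟨y, hy⟩, Subtype.ext (toMapπ_f_apply_val 𝒜 S i ⟨y, hy⟩)⟩

/-- The kernel of `toMapπ` in degree `i` is `𝒜 ∩ S` (pulled back to `S`): `toMapπ s = 0 ↔ s.1 ∈ 𝒜`.
[folklore] -/
lemma toMapπ_f_eq_zero_iff (𝒜 S : Subcomplex K) (i : β) (x : S.toComplex.X i) :
    (toMapπ 𝒜 S).f i x = 0 ↔ x.1 ∈ 𝒜 i := by
  rw [← 𝒜.π_f_eq_zero_iff i x.1, ← toMapπ_f_apply_val 𝒜 S i x]
  exact ⟨fun h ↦ by rw [h]; rfl, fun h ↦ Subtype.ext h⟩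

/-- `toMapπ` is natural in `S`: for `S ≤ T`, `incl ≫ toMapπ T = toMapπ S ≫ incl`. [folklore] -/
@[reassoc]
lemma incl_toMapπ (𝒜 : Subcomplex K) {S T : Subcomplex K} (h : S ≤ T) :
    incl h ≫ toMapπ 𝒜 T = toMapπ 𝒜 S ≫ incl (mapπ_mono 𝒜 h) := by
  ext i x
  apply Subtype.ext
  change ((toMapπ 𝒜 T).f i ((incl h).f i x)).1 = (((incl (mapπ_mono 𝒜 h)).f i) ((toMapπ 𝒜 S).f i x)).1
  rw [toMapπ_f_apply_val, incl_f_apply_val, incl_f_apply_val, toMapπ_f_apply_val]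

/-- **`S/(𝒜 ∩ S) ≅ π(S)`**: `toMapπ` induces an isomorphism of complexes from the quotient of `S`
by `𝒜.comap S.ι` onto `π(S)` (first isomorphism theorem, degreewise).
[cite: HatcherAT2002, §2.2 p. 152] -/
theorem isIso_quotMapToMapπ (𝒜 S : Subcomplex K) :
    IsIso (quotMap (toMapπ 𝒜 S) (𝒜.comap S.ι) ⊥ (fun i x hx ↦ by
      rw [mem_comap, bot_apply, Submodule.mem_bot]
      exact (toMapπ_f_eq_zero_iff 𝒜 S i x).2 hx)) := by
  haveI : ∀ i, IsIso ((quotMap (toMapπ 𝒜 S) (𝒜.comap S.ι) ⊥ (fun i x hx ↦ by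
      rw [mem_comap, bot_apply, Submodule.mem_bot]
      exact (toMapπ_f_eq_zero_iff 𝒜 S i x).2 hx)).f i) := fun i ↦ by
    rw [ConcreteCategory.isIso_iff_bijective]
    constructor
    · intro a b hab
      obtain ⟨a, rfl⟩ := (𝒜.comap S.ι).π_f_surjective i a
      obtain ⟨b, rfl⟩ := (𝒜.comap S.ι).π_f_surjective i b
      rw [quotMap_f_π_f, quotMap_f_π_f, π_f_eq_π_f_iff, bot_apply, Submodule.mem_bot,
        ← map_sub, toMapπ_f_eq_zero_iff] at hab
      exact (π_f_eq_π_f_iff _ i a b).2 hab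
    · intro y
      obtain ⟨y, rfl⟩ := (⊥ : Subcomplex (mapπ 𝒜 S).toComplex).π_f_surjective i y
      obtain ⟨x, rfl⟩ := toMapπ_f_surjective 𝒜 S i y
      exact ⟨(𝒜.comap S.ι).π.f i x, quotMap_f_π_f _ _ _ _ i x⟩
  exact HomologicalComplex.Hom.isIso_of_components _

end Subcomplex

end Literature.AlgebraicTopology.SingularHomology
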